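import Mathlib.Data.Finset.Card
import Mathlib.Data.Fintype.Powerset
import Mathlib.Data.Finset.Lattice.Fold
import Mathlib.Order.ConditionallyCompleteLattice.Basic
import Mathlib.Order.Lattice.Nat
import Mathlib.Algebra.Order.BigOperators.Group.Finset
import Literature.Computability.Complexity.DecisionTree
import HarnessLib

/-!
# Block sensitivity and certificate complexity; Nisan's `C(f) ≤ bs(f)²`

Boolean-function complexity measures of Beals–Buhrman–Cleve–Mosca–de Wolf, *Quantum lower
bounds by polynomials*, J. ACM 48 (2001), §4.3 and §5 (the combinatorial half of the proof of
their Theorem 5.4, `D(f) ≤ 4096 Q₂(f)⁶`; the decision-tree half `D(f) ≤ C⁽¹⁾(f) bs(f)` is the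
follow-up file on Lemma 5.3).

* **Definition 4.11** (block sensitivity): `flipBlock x B = x^B`, `IsSensitiveBlock f x B`
  (`f(x^B) ≠ f(x)`), `IsSensitiveFamily` (pairwise disjoint sensitive blocks),
  `blockSensitivityAt f x = bs_x(f)`, `blockSensitivity f = bs(f)`.
* **Definition 5.1** (certificates): `IsCertificate f x S` (every input agreeing with `x` on `S`
  has `f`-value `f x`), `certificateComplexityAt f x = C_x(f)`,
  `certificateComplexity f = C(f)`, `oneCertificateComplexity f = C⁽¹⁾(f)`.
* **Lemma 5.2** (Nisan): `C⁽¹⁾(f) ≤ C(f) ≤ bs(f)²` (`oneCertificateComplexity_le`,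
  `certificateComplexity_le_sq`), through the sharper printed intermediate
  `C_x(f) ≤ bs_x(f) · bs(f)` (`certificateComplexityAt_le_mul`).

**The printed proof of Lemma 5.2** (p. 10): "Consider an input `X` and let `B_1, …, B_b` be
disjoint minimal sets of variables that achieve the block sensitivity `b = bs_X(f) ≤ bs(f)`.
We will show that `C : ∪_i B_i → {0,1}` which sets variables according to `X`, is a
certificate for `X` of size `≤ bs(f)²`. Firstly, if `C` were not an `f(X)`-certificate then
let `X'` be an input that agrees with `C`, such that `f(X') ≠ f(X)`. Let `X' = X^{B_{b+1}}`. Now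
`f` is sensitive to `B_{b+1}` on `X` and `B_{b+1}` is disjoint from `B_1, …, B_b`, which
contradicts `b = bs_X(f)`" — `certificateComplexityAt_le_mul`, with the minimal blocks chosen
inside an optimal family (`exists_minimalSensitiveBlock_subset`) — and secondly each minimal
block has `|B_i| ≤ bs(f)`, because on `X^{B_i}` every variable of `B_i` is sensitive
(`IsMinimalSensitiveBlock.card_le`).

Design: inputs are `Fin N → Bool` as in `DecisionTree.lean`; blocks are `Finset (Fin N)`,
families `Finset (Finset (Fin N))`; `bs_x`, `bs`, `C`, `C⁽¹⁾` are `Finset.sup` maxima over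
finite types (the empty family and the full certificate `univ` make all extrema attained:
`exists_family_card_eq`, `exists_certificate_card_eq`; `C⁽¹⁾(f) = 0` for `f ≡ 0`), `C_x` is an
`sInf` over `ℕ` of a nonempty set. Sensitivity `s(f)` is not needed (the printed
`C(f) ≤ s(f) bs(f)` is used only through `s(f) ≤ bs(f)`) and is not defined here. Mathlib has no
block sensitivity / certificate complexity (searched `sensitivity`, `certificate`; Huang's
sensitivity theorem lives in `Archive`, not in Mathlib proper).

## References

* R. Beals, H. Buhrman, R. Cleve, M. Mosca, R. de Wolf, *Quantum lower bounds by polynomials*,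
  J. ACM 48 (2001) 778–797, Def. 4.11, Def. 5.1, Lemma 5.2 (arXiv:quant-ph/9802049, pp. 8–10)
  [BealsEtAl2001].
* N. Nisan, *CREW PRAMs and decision trees*, SIAM J. Comput. 20 (1991) 999–1007 (original
  source of Lemma 5.2).
-/

namespace Literature.Computability.Complexity

open Finset

variable {N : ℕ}

/-- Flip the bits of `x` in the block `B`: the input `x^B` of Beals et al. [cite: BealsEtAl2001, Def
4.11] -/
def flipBlock (x : Fin N → Bool) (B : Finset (Fin N)) : Fin N → Bool :=
  fun i => if i ∈ B then !x i else x i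

/-- Inside the block the bit is flipped. [folklore] -/
@[simp] theorem flipBlock_apply_of_mem {x : Fin N → Bool} {B : Finset (Fin N)} {i : Fin N}
    (h : i ∈ B) : flipBlock x B i = !x i := by simp [flipBlock, h]

/-- Outside the block the bit is unchanged. [folklore] -/
@[simp] theorem flipBlock_apply_of_not_mem {x : Fin N → Bool} {B : Finset (Fin N)} {i : Fin N}
    (h : i ∉ B) : flipBlock x B i = x i := by simp [flipBlock, h]

/-- Flipping the empty block does nothing. [folklore] -/
@[simp] theorem flipBlock_empty (x : Fin N → Bool) : flipBlock x ∅ = x := by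
  funext i; simp [flipBlock]

/-- `(x^B)^A = x^{B ∖ A}` for `A ⊆ B`. [folklore] -/
theorem flipBlock_flipBlock_of_subset {x : Fin N → Bool} {A B : Finset (Fin N)} (h : A ⊆ B) :
    flipBlock (flipBlock x B) A = flipBlock x (B \ A) := by
  funext i
  by_cases hA : i ∈ A
  · have hB := h hA
    simp [flipBlock, hA, hB]
  · by_cases hB : i ∈ B <;> simp [flipBlock, hA, hB]

/-- The set of positions where `y` differs from `x` (so that `y = x^{diffSet x y}`). [folklore] -/
def diffSet (x y : Fin N → Bool) : Finset (Fin N) := Finset.univ.filter fun i => y i ≠ x i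

/-- Membership in `diffSet`. [folklore] -/
@[simp] theorem mem_diffSet {x y : Fin N → Bool} {i : Fin N} : i ∈ diffSet x y ↔ y i ≠ x i := by
  simp [diffSet]

/-- `x^{diffSet x y} = y`. [folklore] -/
theorem flipBlock_diffSet (x y : Fin N → Bool) : flipBlock x (diffSet x y) = y := by
  funext i
  by_cases h : y i = x i
  · rw [flipBlock_apply_of_not_mem (by simpa using h), h]
  · rw [flipBlock_apply_of_mem (by simpa using h)]
    cases hx : x i <;> cases hy : y i <;> simp_all

/-- `f` is sensitive to the block `B` on `x`: `f(x^B) ≠ f(x)`. [cite: BealsEtAl2001, Def 4.11] -/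
def IsSensitiveBlock (f : (Fin N → Bool) → Bool) (x : Fin N → Bool) (B : Finset (Fin N)) : Prop :=
  f (flipBlock x B) ≠ f x

/-- A sensitive block is nonempty. [folklore] -/
theorem IsSensitiveBlock.nonempty {f : (Fin N → Bool) → Bool} {x : Fin N → Bool}
    {B : Finset (Fin N)} (h : IsSensitiveBlock f x B) : B.Nonempty := by
  rw [Finset.nonempty_iff_ne_empty]
  rintro rfl
  exact h (by simp)

/-- A family of pairwise disjoint blocks `B_1, …, B_t`, each sensitive for `f` on `x`. [cite:
BealsEtAl2001, Def 4.11] -/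
def IsSensitiveFamily (f : (Fin N → Bool) → Bool) (x : Fin N → Bool)
    (𝓑 : Finset (Finset (Fin N))) : Prop :=
  (∀ B ∈ 𝓑, IsSensitiveBlock f x B) ∧ (𝓑 : Set (Finset (Fin N))).PairwiseDisjoint id

/-- The empty family is a sensitive family. [folklore] -/
theorem isSensitiveFamily_empty (f : (Fin N → Bool) → Bool) (x : Fin N → Bool) :
    IsSensitiveFamily f x ∅ := ⟨by simp, by simp⟩

open Classical in
/-- The block sensitivity `bs_x(f)` of `f` on `x`: "the maximum number `t` for which there
exist `t` disjoint sets of indices `B_1, …, B_t` such that `f` is sensitive to each `B_i` on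
`x`" (a `Finset.sup` over all families; attained, `exists_family_card_eq`). [cite: BealsEtAl2001,
Def 4.11] -/
noncomputable def blockSensitivityAt (f : (Fin N → Bool) → Bool) (x : Fin N → Bool) : ℕ :=
  (Finset.univ.filter (IsSensitiveFamily f x)).sup Finset.card

/-- The block sensitivity `bs(f) = max_x bs_x(f)`. [cite: BealsEtAl2001, Def 4.11] -/
noncomputable def blockSensitivity (f : (Fin N → Bool) → Bool) : ℕ :=
  Finset.univ.sup (blockSensitivityAt f)

/-- Every sensitive family on `x` has at most `bs_x(f)` blocks. [cite: BealsEtAl2001, Def 4.11] -/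
theorem IsSensitiveFamily.card_le {f : (Fin N → Bool) → Bool} {x : Fin N → Bool}
    {𝓑 : Finset (Finset (Fin N))} (h : IsSensitiveFamily f x 𝓑) :
    𝓑.card ≤ blockSensitivityAt f x := by
  classical
  exact Finset.le_sup (f := Finset.card) (by simpa using h)

/-- `bs_x(f)` is attained by some sensitive family. [cite: BealsEtAl2001, Def 4.11] -/
theorem exists_family_card_eq (f : (Fin N → Bool) → Bool) (x : Fin N → Bool) :
    ∃ 𝓑, IsSensitiveFamily f x 𝓑 ∧ 𝓑.card = blockSensitivityAt f x := by
  classical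
  obtain ⟨𝓑, h𝓑, hcard⟩ := Finset.exists_mem_eq_sup (Finset.univ.filter (IsSensitiveFamily f x))
    ⟨∅, by simpa using isSensitiveFamily_empty f x⟩ Finset.card
  exact ⟨𝓑, by simpa using h𝓑, hcard.symm⟩

/-- `bs_x(f) ≤ bs(f)`. [cite: BealsEtAl2001, Def 4.11] -/
theorem blockSensitivityAt_le (f : (Fin N → Bool) → Bool) (x : Fin N → Bool) :
    blockSensitivityAt f x ≤ blockSensitivity f :=
  Finset.le_sup (f := blockSensitivityAt f) (Finset.mem_univ x)

/-- Every sensitive family on `x` has at most `bs_x(f)` blocks. [cite: BealsEtAl2001, Def 4.11] -/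
theorem IsSensitiveFamily.card_le_blockSensitivity {f : (Fin N → Bool) → Bool} {x : Fin N → Bool}
    {𝓑 : Finset (Finset (Fin N))} (h : IsSensitiveFamily f x 𝓑) :
    𝓑.card ≤ blockSensitivity f :=
  h.card_le.trans (blockSensitivityAt_le f x)

/-! ### Minimal sensitive blocks have size at most `bs(f)` -/

/-- A minimal sensitive block: sensitive on `x`, and no proper subset is sensitive on `x` (proof of
Lemma 5.2). [cite: BealsEtAl2001, Lemma 5.2] -/
def IsMinimalSensitiveBlock (f : (Fin N → Bool) → Bool) (x : Fin N → Bool)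
    (B : Finset (Fin N)) : Prop :=
  IsSensitiveBlock f x B ∧ ∀ B' ⊂ B, ¬ IsSensitiveBlock f x B'

/-- Every sensitive block contains a minimal sensitive block (one of least size). [cite:
BealsEtAl2001, Lemma 5.2] -/
theorem exists_minimalSensitiveBlock_subset {f : (Fin N → Bool) → Bool} {x : Fin N → Bool}
    {B : Finset (Fin N)} (h : IsSensitiveBlock f x B) :
    ∃ M ⊆ B, IsMinimalSensitiveBlock f x M := by
  classical
  obtain ⟨M, hM, hmin⟩ := Finset.exists_min_image (B.powerset.filter (IsSensitiveBlock f x))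
    Finset.card ⟨B, by simpa using h⟩
  simp only [Finset.mem_filter, Finset.mem_powerset] at hM hmin
  refine ⟨M, hM.1, hM.2, fun B' hB' hs => ?_⟩
  have := hmin B' ⟨hB'.1.trans hM.1, hs⟩
  exact absurd (Finset.card_lt_card hB') (not_lt.mpr this)

/-- On `x^M`, for a minimal sensitive block `M` of `x`, every variable of `M` is sensitive, so
`|M| ≤ bs_{x^M}(f) ≤ bs(f)` (the step `|B_i| ≤ s(f) ≤ bs(f)` of Lemma 5.2). [cite: BealsEtAl2001,
Lemma 5.2] -/
theorem IsMinimalSensitiveBlock.card_le {f : (Fin N → Bool) → Bool} {x : Fin N → Bool}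
    {M : Finset (Fin N)} (h : IsMinimalSensitiveBlock f x M) : M.card ≤ blockSensitivity f := by
  classical
  have hfam : IsSensitiveFamily f (flipBlock x M) (M.image fun i => ({i} : Finset (Fin N))) := by
    constructor
    · intro B hB
      obtain ⟨i, hi, rfl⟩ := Finset.mem_image.mp hB
      unfold IsSensitiveBlock
      rw [flipBlock_flipBlock_of_subset (Finset.singleton_subset_iff.mpr hi)]
      have hsub : M \ {i} ⊂ M := Finset.sdiff_ssubset (Finset.singleton_subset_iff.mpr hi)
        (Finset.singleton_nonempty i)
      have h1 : f (flipBlock x (M \ {i})) = f x := by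
        by_contra hne
        exact h.2 _ hsub hne
      rw [h1]
      exact fun heq => h.1 heq.symm
    · intro B₁ hB₁ B₂ hB₂ hne
      obtain ⟨i, hi, rfl⟩ := Finset.mem_image.mp hB₁
      obtain ⟨j, hj, rfl⟩ := Finset.mem_image.mp hB₂
      simp only [Function.onFun, id]
      rw [Finset.disjoint_singleton_left, Finset.mem_singleton]
      intro hij
      exact hne (by rw [hij])
  have hcard : (M.image fun i => ({i} : Finset (Fin N))).card = M.card :=
    Finset.card_image_of_injective _ Finset.singleton_injective
  rw [← hcard]
  exact hfam.card_le_blockSensitivity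

/-! ### Certificates and Nisan's lemma `C(f) ≤ bs(f)²` -/

/-- `S` (with the values of `x` on `S`) is an `f(x)`-certificate that agrees with `x`: "an
assignment `C : S → {0,1}` of values to some subset `S` of the `N` variables, such that
`f(X) = f(x)` whenever `X` is consistent with `C`". [cite: BealsEtAl2001, Def 5.1] -/
def IsCertificate (f : (Fin N → Bool) → Bool) (x : Fin N → Bool) (S : Finset (Fin N)) : Prop :=
  ∀ y : Fin N → Bool, (∀ i ∈ S, y i = x i) → f y = f x

/-- The set of all variables is a certificate. [folklore] -/
theorem isCertificate_univ (f : (Fin N → Bool) → Bool) (x : Fin N → Bool) :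
    IsCertificate f x Finset.univ := fun y hy => by
  rw [show y = x from funext fun i => hy i (Finset.mem_univ i)]

/-- The certificate complexity `C_x(f)`: "the size of a smallest `f(x)`-certificate that agrees
with `x`" (an `sInf` over `ℕ`; the set is nonempty since all of `univ` is a certificate,
`exists_certificate_card_eq`). [cite: BealsEtAl2001, Def 5.1] -/
noncomputable def certificateComplexityAt (f : (Fin N → Bool) → Bool) (x : Fin N → Bool) : ℕ :=
  sInf {k | ∃ S, IsCertificate f x S ∧ S.card = k}

/-- The certificate complexity `C(f) = max_x C_x(f)`. [cite: BealsEtAl2001, Def 5.1] -/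
noncomputable def certificateComplexity (f : (Fin N → Bool) → Bool) : ℕ :=
  Finset.univ.sup (certificateComplexityAt f)

open Classical in
/-- The `1`-certificate complexity `C⁽¹⁾(f) = max_{x : f(x) = 1} C_x(f)` (`0` if `f` has no
`1`-input). [cite: BealsEtAl2001, Def 5.1] -/
noncomputable def oneCertificateComplexity (f : (Fin N → Bool) → Bool) : ℕ :=
  (Finset.univ.filter fun x => f x = true).sup (certificateComplexityAt f)

/-- `C_x(f)` is attained by some certificate. [cite: BealsEtAl2001, Def 5.1] -/
theorem exists_certificate_card_eq (f : (Fin N → Bool) → Bool) (x : Fin N → Bool) :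
    ∃ S, IsCertificate f x S ∧ S.card = certificateComplexityAt f x :=
  Nat.sInf_mem (s := {k | ∃ S, IsCertificate f x S ∧ S.card = k})
    ⟨_, Finset.univ, isCertificate_univ f x, rfl⟩

/-- Any certificate bounds `C_x(f)` by its size. [cite: BealsEtAl2001, Def 5.1] -/
theorem IsCertificate.certificateComplexityAt_le {f : (Fin N → Bool) → Bool} {x : Fin N → Bool}
    {S : Finset (Fin N)} (h : IsCertificate f x S) : certificateComplexityAt f x ≤ S.card :=
  Nat.sInf_le ⟨S, h, rfl⟩

/-- `C_x(f) ≤ C(f)`. [cite: BealsEtAl2001, Def 5.1] -/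
theorem certificateComplexityAt_le (f : (Fin N → Bool) → Bool) (x : Fin N → Bool) :
    certificateComplexityAt f x ≤ certificateComplexity f :=
  Finset.le_sup (f := certificateComplexityAt f) (Finset.mem_univ x)

/-- `C_x(f) ≤ C⁽¹⁾(f)` for a `1`-input `x`. [cite: BealsEtAl2001, Def 5.1] -/
theorem certificateComplexityAt_le_one {f : (Fin N → Bool) → Bool} {x : Fin N → Bool}
    (hx : f x = true) : certificateComplexityAt f x ≤ oneCertificateComplexity f := by
  classical
  exact Finset.le_sup (f := certificateComplexityAt f) (by simpa using hx)

/-- `C⁽¹⁾(f) ≤ C(f)` ("the first inequality is obvious from the definitions"). [cite: BealsEtAl2001,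
Lemma 5.2] -/
theorem oneCertificateComplexity_le (f : (Fin N → Bool) → Bool) :
    oneCertificateComplexity f ≤ certificateComplexity f := by
  classical
  exact Finset.sup_mono (Finset.filter_subset _ _)

/-- **Nisan's lemma, sharp intermediate form** (proof of Beals et al. Lemma 5.2): the union of
disjoint minimal sensitive blocks achieving `bs_x(f)` is a certificate for `x` of size
`≤ bs_x(f) · bs(f)`, so `C_x(f) ≤ bs_x(f) · bs(f)`. [cite: BealsEtAl2001, Lemma 5.2] -/
theorem certificateComplexityAt_le_mul (f : (Fin N → Bool) → Bool) (x : Fin N → Bool) :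
    certificateComplexityAt f x ≤ blockSensitivityAt f x * blockSensitivity f := by
  classical
  obtain ⟨𝓑, h𝓑, hcard⟩ := exists_family_card_eq f x
  -- minimal sub-blocks
  have hmin : ∀ B ∈ 𝓑, ∃ M ⊆ B, IsMinimalSensitiveBlock f x M := fun B hB =>
    exists_minimalSensitiveBlock_subset (h𝓑.1 B hB)
  choose! m hmsub hmmin using hmin
  set U : Finset (Fin N) := 𝓑.biUnion m with hU
  -- `U` is a certificate
  have hcert : IsCertificate f x U := by
    intro y hy
    by_contra hne
    set D := diffSet x y with hD
    have hDsens : IsSensitiveBlock f x D := by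
      unfold IsSensitiveBlock; rwa [hD, flipBlock_diffSet]
    have hDU : Disjoint D U := by
      rw [Finset.disjoint_left]
      intro i hiD hiU
      exact (mem_diffSet.mp hiD) (hy i hiU)
    -- the family of minimal blocks plus `D`
    set 𝓑' := 𝓑.image m with h𝓑'
    have hinj : Set.InjOn m 𝓑 := by
      intro B₁ hB₁ B₂ hB₂ heq
      by_contra hne'
      have hdis : Disjoint B₁ B₂ := h𝓑.2 hB₁ hB₂ hne'
      have hne1 : (m B₁).Nonempty := (hmmin B₁ hB₁).1.nonempty
      obtain ⟨i, hi⟩ := hne1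
      exact Finset.disjoint_left.mp hdis (hmsub B₁ hB₁ hi) (hmsub B₂ hB₂ (heq ▸ hi))
    have hfam' : IsSensitiveFamily f x (insert D 𝓑') := by
      constructor
      · intro B hB
        rcases Finset.mem_insert.mp hB with rfl | hB
        · exact hDsens
        · obtain ⟨B₀, hB₀, rfl⟩ := Finset.mem_image.mp hB
          exact (hmmin B₀ hB₀).1
      · intro B₁ hB₁ B₂ hB₂ hne'
        simp only [Function.onFun, id]
        have hsubU : ∀ B ∈ 𝓑', B ⊆ U := by
          intro B hB
          obtain ⟨B₀, hB₀, rfl⟩ := Finset.mem_image.mp hB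
          exact Finset.subset_biUnion_of_mem m hB₀
        rcases Finset.mem_insert.mp hB₁ with rfl | hB₁' <;>
          rcases Finset.mem_insert.mp hB₂ with rfl | hB₂'
        · exact absurd rfl hne'
        · exact hDU.mono_right (hsubU _ hB₂')
        · exact (hDU.mono_right (hsubU _ hB₁')).symm
        · obtain ⟨C₁, hC₁, rfl⟩ := Finset.mem_image.mp hB₁'
          obtain ⟨C₂, hC₂, rfl⟩ := Finset.mem_image.mp hB₂'
          have hC : C₁ ≠ C₂ := fun h => hne' (by rw [h])
          exact (h𝓑.2 hC₁ hC₂ hC).mono (hmsub C₁ hC₁) (hmsub C₂ hC₂)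
    have hDnot : D ∉ 𝓑' := by
      intro hD'
      obtain ⟨B₀, hB₀, hB₀D⟩ := Finset.mem_image.mp hD'
      obtain ⟨i, hi⟩ := (hmmin B₀ hB₀).1.nonempty
      have hiU : i ∈ U := Finset.subset_biUnion_of_mem m hB₀ hi
      exact Finset.disjoint_left.mp hDU (hB₀D ▸ hi) hiU
    have hcard' : (insert D 𝓑').card = blockSensitivityAt f x + 1 := by
      rw [Finset.card_insert_of_notMem hDnot, h𝓑', Finset.card_image_of_injOn hinj, hcard]
    have := hfam'.card_le
    omega
  -- size of `U`
  calc certificateComplexityAt f x ≤ U.card := hcert.certificateComplexityAt_le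
    _ ≤ ∑ B ∈ 𝓑, (m B).card := Finset.card_biUnion_le
    _ ≤ ∑ B ∈ 𝓑, blockSensitivity f :=
        Finset.sum_le_sum fun B hB => (hmmin B hB).card_le
    _ = blockSensitivityAt f x * blockSensitivity f := by
        rw [Finset.sum_const, smul_eq_mul, hcard]

/-- **Nisan's lemma** (Beals et al. Lemma 5.2: "`C⁽¹⁾(f) ≤ C(f) ≤ bs(f)²`"), second inequality.
[cite: BealsEtAl2001, Lemma 5.2] -/
theorem certificateComplexity_le_sq (f : (Fin N → Bool) → Bool) :
    certificateComplexity f ≤ blockSensitivity f ^ 2 := by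
  refine Finset.sup_le fun x _ => ?_
  calc certificateComplexityAt f x ≤ blockSensitivityAt f x * blockSensitivity f :=
        certificateComplexityAt_le_mul f x
    _ ≤ blockSensitivity f * blockSensitivity f :=
        Nat.mul_le_mul_right _ (blockSensitivityAt_le f x)
    _ = blockSensitivity f ^ 2 := (sq _).symm

end Literature.Computability.Complexity
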